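import Summits.ValiantsHypothesis.ValiantsHypothesis.Theorems.PolyaContinuedMonotoneCoverHardClosedWalk
import Summits.ValiantsHypothesis.ValiantsHypothesis.Theorems.PolyaContinuedMonotoneCoverHardWidthTwo

/-!
# Crux `MonotoneCoverHard` (stmt-ValiantsHypothesis-7421): every label-bijective cover whose nonzero
edges are all used HAS A LEVEL FUNCTION

Stub A of the WIDTH line, in kernel (val-width-7421-p2 g0, 2026-08-27).  For a cover `(m, E, a)` of
`per_n` (labels in `{X j, 0, 1}`, `per_n = aeval a PM_E`; the Pfaffian signing is not needed) in which
every edge of `E` with nonzero label lies in some weight-nonzero perfect matching (`hused` — always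
achievable by discarding unused edges, which touches no stub), there is `g : Fin m ⊕ Fin m → ℕ` with
`g(col j) = g(row i) + [a (i, j) is a variable]` along every nonzero edge (`exists_level_function`).

Proof (elementary, no matching-polytope theory).  Fix a weight-nonzero perfect matching `τ₀`
(it exists: the cover realises the identity permutation).  On rows put the ARC relation
`r → r'` iff `r ≠ r'` and `(r, τ₀ r')` is a nonzero edge, with weight
`Λ r r' = w(r, τ₀ r') − w(r, τ₀ r)`, `w = [label is a variable]`.
* Return walks (`HB`): a nonzero edge `(r, τ₀ r')` is used by some weight-nonzero `τ` with
  `τ r = τ₀ r'`; iterating the permutation `ρ = τ₀⁻¹ ∘ τ` from `r'` walks along arcs back to `r`.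
* Simple closed walks have weight `0` (`HS`): the vertices of a simple closed walk `c ++ [c.head]`
  define the permutation `c.formPerm`, and `σ = τ₀ ∘ c.formPerm` is a weight-nonzero perfect matching
  (its new edges are the arcs of the walk); `σ` and `τ₀` both have exactly `n` variable edges
  (`card_var_eq_n`), and the difference of these counts is the weight of the walk
  (`sum_zipWith_cycle_eq_sum_map_formPerm`).
* `exists_potential` (`…ClosedWalk.lean`) gives `φ` on rows with `φ r' = φ r + Λ r r'` on arcs;
  `g(col τ₀ r) = φ r`, `g(row r) = φ r − w(r, τ₀ r)`, shifted into `ℕ`, is the level function.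

With `…WidthTwo.lean` (width profile invariance, dichotomy) and `…WidthCut.lean` (the layer-cut rung)
this makes the structural half of the width line fully kernel: MonotoneCoverHard follows from the WIDTH
bet alone.  VP ≠ VNP is not moved.  No definitions.
-/

namespace Summit.ValiantsHypothesis.ValiantsHypothesis.Theorems.PolyaContinuedMonotoneCoverHard

-- summit = sub-problem name (single-conjunct summit, D-0017 layout), so the namespace repeats it
set_option linter.dupNamespace false

open scoped Classical
open Finset
open Summit.ValiantsHypothesis.ValiantsHypothesis.Theorems.PolyaContinued.MonotoneCoverHardRectangle
  (exists_labels aeval_permanent_cover perPoly_eq_sum_monomial label_bijection pexp_injective)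

/-- Iterating a permutation along an orbit of size `≥ 2` walks along arcs: if `r ≠ ρ r` and every
`y = ρ^j r` satisfies `arc y (ρ y)`, then `ρ r :: [ρ² r, …, ρ^N r]` (`N = orderOf ρ`) is an `arc`-chain
from `ρ r` back to `r`. -/
theorem exists_walk_of_perm {m : ℕ} (arc : Fin m → Fin m → Prop) (ρ : Equiv.Perm (Fin m)) (r : Fin m)
    (harc : ∀ j : ℕ, arc ((ρ ^ j) r) ((ρ ^ (j + 1)) r)) :
    ∃ l : List (Fin m), List.IsChain arc (ρ r :: l) ∧ (ρ r :: l).getLast (List.cons_ne_nil _ _) = r := by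
  set N := orderOf ρ with hN
  have hNpos : 0 < N := orderOf_pos ρ
  have hρN : (ρ ^ N) r = r := by rw [hN, pow_orderOf_eq_one]; rfl
  set L : List (Fin m) := ρ r :: (List.range (N - 1)).map (fun j => (ρ ^ (j + 2)) r) with hL
  have hlen : L.length = N := by simp [hL]; omega
  have hget : ∀ (k : ℕ) (hk : k < L.length), L[k] = (ρ ^ (k + 1)) r := by
    intro k hk
    cases k with
    | zero => simp [hL]
    | succ k => simp [hL]
  refine ⟨(List.range (N - 1)).map (fun j => (ρ ^ (j + 2)) r), ?_, ?_⟩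
  · show List.IsChain arc L
    rw [List.isChain_iff_getElem]
    intro i hi
    rw [hget, hget]
    exact harc (i + 1)
  · show L.getLast _ = r
    rw [List.getLast_eq_getElem, hget]
    rw [hlen, Nat.sub_add_cancel hNpos]
    exact hρN

/-- **Every label-bijective cover all of whose nonzero edges are used has a level function.** -/
theorem exists_level_function (n m : ℕ) (E : Finset (Fin m × Fin m))
    (a : Fin m × Fin m → MvPolynomial (Fin n × Fin n) ℂ)
    (ha : ∀ e, (∃ j, a e = MvPolynomial.X j) ∨ a e = 0 ∨ a e = 1)
    (hper : Literature.Computability.AlgebraicComplexity.perPoly (Fin n) ℂ =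
      MvPolynomial.aeval a (Matrix.of fun i j => if (i, j) ∈ E then MvPolynomial.X (i, j) else 0 :
          Matrix (Fin m) (Fin m) (MvPolynomial (Fin m × Fin m) ℂ)).permanent)
    (hused : ∀ i j, (i, j) ∈ E → a (i, j) ≠ 0 →
      ∃ τ : Equiv.Perm (Fin m), (∀ k, (k, τ k) ∈ E ∧ a (k, τ k) ≠ 0) ∧ τ i = j) :
    ∃ g : Fin m ⊕ Fin m → ℕ,
      (∀ i j, (i, j) ∈ E → (∃ k, a (i, j) = MvPolynomial.X k) →
        g (Sum.inr j) = g (Sum.inl i) + 1) ∧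
      (∀ i j, (i, j) ∈ E → a (i, j) ≠ 0 → (¬ ∃ k, a (i, j) = MvPolynomial.X k) →
        g (Sum.inr j) = g (Sum.inl i)) := by
  -- a reference weight-nonzero perfect matching `τ₀`
  obtain ⟨δ, hδ, -, -⟩ := exists_labels a ha
  set G := Finset.univ.filter fun τ : Equiv.Perm (Fin m) => ∀ i, (i, τ i) ∈ E ∧ a (i, τ i) ≠ 0
    with hG
  have hsum : ∑ τ ∈ G, MvPolynomial.monomial (∑ i, δ (i, τ i)) (1 : ℂ) =
      ∑ σ : Equiv.Perm (Fin n), MvPolynomial.monomial (∑ k, Finsupp.single (k, σ k) 1) (1 : ℂ) := by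
    rw [← aeval_permanent_cover E a δ hδ G hG, ← hper, perPoly_eq_sum_monomial]
  obtain ⟨-, -, hsurj⟩ := label_bijection G (fun τ => ∑ i, δ (i, τ i))
    (fun σ : Equiv.Perm (Fin n) => ∑ k, Finsupp.single (k, σ k) (1 : ℕ)) pexp_injective hsum
  obtain ⟨τ₀, hτ₀G, -⟩ := hsurj 1
  have hτ₀ : ∀ i, (i, τ₀ i) ∈ E ∧ a (i, τ₀ i) ≠ 0 := by
    rw [hG] at hτ₀G; exact (Finset.mem_filter.1 hτ₀G).2
  -- weights, arcs
  set w : Fin m × Fin m → ℤ := fun e => if (∃ k, a e = MvPolynomial.X k) then 1 else 0 with hw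
  set arc : Fin m → Fin m → Prop := fun r r' => r ≠ r' ∧ (r, τ₀ r') ∈ E ∧ a (r, τ₀ r') ≠ 0
    with harc
  set Λ : Fin m → Fin m → ℤ := fun r r' => w (r, τ₀ r') - w (r, τ₀ r) with hΛ
  -- the number of variable edges of a weight-nonzero matching, as a sum of weights
  have hcount : ∀ σ : Equiv.Perm (Fin m), (∀ i, (i, σ i) ∈ E ∧ a (i, σ i) ≠ 0) →
      ∑ x : Fin m, w (x, σ x) = n := by
    intro σ hσ
    have h1 := card_var_eq_n E a ha hper σ hσ
    simp only [hw]
    rw [Finset.sum_boole]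
    exact_mod_cast h1
  -- HB: return walks
  have HB : ∀ u v, arc u v → ∃ l : List (Fin m), List.IsChain arc (v :: l) ∧
      (v :: l).getLast (List.cons_ne_nil _ _) = u := by
    intro u v huv
    obtain ⟨hne, hE, hnz⟩ := huv
    obtain ⟨τ, hτ, hτu⟩ := hused u (τ₀ v) hE hnz
    set ρ : Equiv.Perm (Fin m) := τ.trans τ₀.symm with hρ
    have hρu : ρ u = v := by simp [hρ, hτu]
    have hρapp : ∀ y, τ₀ (ρ y) = τ y := by intro y; simp [hρ]
    -- no point of the orbit of `u` is fixed
    have hnofix : ∀ j : ℕ, ρ ((ρ ^ j) u) ≠ (ρ ^ j) u := by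
      intro j hfix
      have hall : ∀ k : ℕ, (ρ ^ k) ((ρ ^ j) u) = (ρ ^ j) u := by
        intro k
        induction k with
        | zero => simp
        | succ k ih => rw [pow_succ', Equiv.Perm.mul_apply, ih, hfix]
      have h1 : (ρ ^ (orderOf ρ - j % orderOf ρ)) ((ρ ^ j) u) = (ρ ^ j) u := hall _
      have h2 : (ρ ^ (orderOf ρ - j % orderOf ρ)) ((ρ ^ j) u) = u := by
        rw [← Equiv.Perm.mul_apply, ← pow_add]
        have hj : j % orderOf ρ ≤ orderOf ρ := (Nat.mod_lt _ (orderOf_pos ρ)).le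
        have : orderOf ρ - j % orderOf ρ + j = orderOf ρ * (1 + j / orderOf ρ) := by
          have := Nat.div_add_mod j (orderOf ρ)
          rw [Nat.mul_add, Nat.mul_one]
          omega
        rw [this, pow_mul, pow_orderOf_eq_one, one_pow]
        rfl
      have h3 : (ρ ^ j) u = u := h1.symm.trans h2
      have h4 : ρ u = u := by
        have := hfix
        rw [h3] at this
        exact this
      exact hne (h4 ▸ hρu.symm).symm
    obtain ⟨l, hl, el⟩ := exists_walk_of_perm arc ρ u (fun j => by
      refine ⟨?_, ?_, ?_⟩
      · rw [pow_succ', Equiv.Perm.mul_apply]; exact (hnofix j).symm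
      · rw [pow_succ', Equiv.Perm.mul_apply, hρapp]; exact (hτ _).1
      · rw [pow_succ', Equiv.Perm.mul_apply, hρapp]; exact (hτ _).2)
    rw [hρu] at hl el
    exact ⟨l, hl, el⟩
  -- HS: simple closed walks have weight 0
  have HS : ∀ (l : List (Fin m)) (hl : l ≠ []), List.IsChain arc l → l.head hl = l.getLast hl →
      l.tail.Nodup → (List.zipWith Λ l l.tail).sum = 0 := by
    intro l hl hch hcl hnd
    obtain ⟨v, t, rfl⟩ : ∃ v t, l = v :: t := by
      cases l with
      | nil => exact absurd rfl hl
      | cons v t => exact ⟨v, t, rfl⟩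
    rcases t.eq_nil_or_concat with ht | ⟨t', y, ht⟩
    · subst ht; simp
    rw [List.concat_eq_append] at ht
    subst ht
    simp only [List.tail_cons] at hnd
    have hy : (v :: (t' ++ [y])).getLast hl = y := by simp
    rw [hy, List.head_cons] at hcl
    subst hcl
    -- the cycle `c = v :: t'` is duplicate-free and the walk is `c ++ [c.head]`
    set c : List (Fin m) := v :: t' with hc
    have hcnd : c.Nodup := by
      rw [hc, List.nodup_cons]
      rw [List.nodup_append] at hnd
      refine ⟨fun hv => ?_, hnd.1⟩
      exact hnd.2.2 v hv v (List.mem_singleton_self _) rfl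
    have hcne : c ≠ [] := List.cons_ne_nil _ _
    have hlist : v :: (t' ++ [v]) = c ++ [c.head hcne] := by simp [hc]
    rw [hlist] at hch ⊢
    rw [sum_zipWith_cycle_eq_sum_map_formPerm Λ c hcnd hcne]
    have harcs := arc_formPerm_of_isChain_cycle arc c hcnd hcne hch
    -- the flipped matching σ = τ₀ ∘ formPerm
    set π := c.formPerm with hπ
    set σ : Equiv.Perm (Fin m) := π.trans τ₀ with hσdef
    have hσapp : ∀ x, σ x = τ₀ (π x) := fun x => rfl
    have hσ : ∀ x, (x, σ x) ∈ E ∧ a (x, σ x) ≠ 0 := by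
      intro x
      rw [hσapp]
      by_cases hx : x ∈ c
      · exact ⟨(harcs x hx).2.1, (harcs x hx).2.2⟩
      · rw [hπ, List.formPerm_apply_of_notMem hx]; exact hτ₀ x
    have hoff : ∀ x, x ∉ c → Λ x (π x) = 0 := by
      intro x hx
      simp only [hΛ, hπ, List.formPerm_apply_of_notMem hx, sub_self]
    -- Σ_{x ∈ c} Λ x (π x) = Σ_x (w (x, σ x) - w (x, τ₀ x)) = n - n
    rw [← List.sum_toFinset _ hcnd]
    rw [Finset.sum_subset (Finset.subset_univ c.toFinset)
      (fun x _ hx => hoff x (fun h => hx (List.mem_toFinset.2 h)))]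
    have : ∑ x : Fin m, Λ x (π x) = ∑ x : Fin m, w (x, σ x) - ∑ x : Fin m, w (x, τ₀ x) := by
      rw [← Finset.sum_sub_distrib]
      exact Finset.sum_congr rfl fun x _ => by simp only [hΛ, hσapp]
    rw [this, hcount σ hσ, hcount τ₀ hτ₀, sub_self]
  -- the potential and the level function
  obtain ⟨φ, hφ⟩ := exists_potential arc Λ HB HS
  set gz : Fin m ⊕ Fin m → ℤ := fun x => Sum.elim (fun r => φ r - w (r, τ₀ r)) (fun c => φ (τ₀.symm c)) x
    with hgz
  have hedge : ∀ i j, (i, j) ∈ E → a (i, j) ≠ 0 → gz (Sum.inr j) = gz (Sum.inl i) + w (i, j) := by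
    intro i j hE hnz
    simp only [hgz, Sum.elim_inl, Sum.elim_inr]
    by_cases hij : i = τ₀.symm j
    · have : j = τ₀ i := by rw [hij]; simp
      subst this
      simp
    · have harc' : arc i (τ₀.symm j) := by
        refine ⟨hij, ?_, ?_⟩ <;> simpa using ‹_›
      have := hφ i (τ₀.symm j) harc'
      simp only [hΛ, Equiv.apply_symm_apply] at this
      linarith
  -- shift into ℕ
  set K : ℤ := ∑ x : Fin m ⊕ Fin m, |gz x| with hK
  have hK0 : ∀ x, 0 ≤ gz x + K := by
    intro x
    have h1 : |gz x| ≤ K := by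
      rw [hK]
      exact Finset.single_le_sum (f := fun x => |gz x|) (fun _ _ => abs_nonneg _) (Finset.mem_univ x)
    have h2 := neg_abs_le (gz x)
    linarith
  refine ⟨fun x => (gz x + K).toNat, ?_, ?_⟩
  · intro i j hE hv
    show (gz (Sum.inr j) + K).toNat = (gz (Sum.inl i) + K).toNat + 1
    have hnz : a (i, j) ≠ 0 := by
      obtain ⟨k, hk⟩ := hv; rw [hk]; exact MvPolynomial.X_ne_zero k
    have h := hedge i j hE hnz
    have hw1 : w (i, j) = 1 := by simp only [hw, if_pos hv]
    have e1 := Int.toNat_of_nonneg (hK0 (Sum.inr j))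
    have e2 := Int.toNat_of_nonneg (hK0 (Sum.inl i))
    omega
  · intro i j hE hnz hnv
    show (gz (Sum.inr j) + K).toNat = (gz (Sum.inl i) + K).toNat
    have h := hedge i j hE hnz
    have hw0 : w (i, j) = 0 := by simp only [hw, if_neg hnv]
    have e1 := Int.toNat_of_nonneg (hK0 (Sum.inr j))
    have e2 := Int.toNat_of_nonneg (hK0 (Sum.inl i))
    omega

end Summit.ValiantsHypothesis.ValiantsHypothesis.Theorems.PolyaContinuedMonotoneCoverHard
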